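import Mathlib
import Summits.NavierStokesRegularity.NavierStokesRegularity.Theorems.FilamentSkeletonRssStadiumVerticalLinear

/-!
# Vertical displacement minus its linear part — BOTH SIGNS of the height (`TangentSkeletonNearStraightL`, stmt-NavierStokesRegularity-23320,
# registered stub `stub_stripPropagation`)

Theorems.StadiumVerticalLinear.vertical_sub_linear_norm_le treats `y ≥ 0`.  The holomorphic point reflection `w ↦ 2x − w` through the real foot
(as in Theorems.StadiumDeviationReflect) transports it to `y ≤ 0`: `‖F(x+iy) − F(x) − (iy)•F′(x)‖ ≤ β₁·|y|` whenever
`‖F′(x+it) − F′(x)‖ ≤ β₁` for `t` between `0` and `y` (`vertical_sub_linear_norm_le_abs`).  Input of the sign-free own-filament far kernel.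
HONEST FRAMING: a tool for a HYPOTHETICAL filament skeleton on the NEGATIVE side of a MODEL route; nothing here bears on Navier–Stokes regularity or
blow-up.  `--supports stmt-NavierStokesRegularity-23320`.
-/

set_option linter.dupNamespace false

noncomputable section

namespace Summit.NavierStokesRegularity.NavierStokesRegularity.Theorems.StadiumVerticalLinearAbs

open Set Metric
open Summit.NavierStokesRegularity.NavierStokesRegularity.Theorems.StadiumVerticalLinear

/-- **Vertical displacement minus its linear part, `y ≤ 0`.** [folklore] -/
theorem vertical_sub_linear_norm_le_nonpos {U : Set ℂ} (hU : IsOpen U) {F : ℂ → (Fin 3 → ℂ)} (hF : DifferentiableOn ℂ F U)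
    {x y β₁ : ℝ} (hy : y ≤ 0) (hmem : ∀ t ∈ Icc y 0, (x : ℂ) + (t : ℂ) * Complex.I ∈ U)
    (hdev : ∀ t ∈ Icc y 0, ‖deriv F ((x : ℂ) + (t : ℂ) * Complex.I) - deriv F (x : ℂ)‖ ≤ β₁) :
    ‖F ((x : ℂ) + (y : ℂ) * Complex.I) - F (x : ℂ) - ((y : ℂ) * Complex.I) • deriv F (x : ℂ)‖ ≤ β₁ * |y| := by
  -- reflected data
  set ρ : ℂ → ℂ := fun w => 2 * (x : ℂ) - w with hρ
  set U' : Set ℂ := ρ ⁻¹' U with hU'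
  set F' : ℂ → (Fin 3 → ℂ) := fun w => F (ρ w) with hF'
  have hρc : Continuous ρ := continuous_const.sub continuous_id
  have hU'o : IsOpen U' := hU.preimage hρc
  have hρd : ∀ w, HasDerivAt ρ (-1) w := by
    intro w
    have h := ((hasDerivAt_id w).const_sub (2 * (x : ℂ)))
    simpa [hρ] using h
  have hF'd : DifferentiableOn ℂ F' U' := by
    intro w hw
    have h1 : DifferentiableAt ℂ F (ρ w) := hF.differentiableAt (hU.mem_nhds hw)
    exact (h1.comp w (hρd w).differentiableAt).differentiableWithinAt
  have hderiv : ∀ w, ρ w ∈ U → deriv F' w = -deriv F (ρ w) := by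
    intro w hw
    have h1 : HasDerivAt F (deriv F (ρ w)) (ρ w) := (hF.differentiableAt (hU.mem_nhds hw)).hasDerivAt
    have h2 := h1.scomp w (hρd w)
    have h3 : deriv F' w = ((-1 : ℂ) • deriv F (ρ w)) := h2.deriv
    rw [h3, neg_one_smul]
  have hρt : ∀ t : ℝ, ρ ((x : ℂ) + (t : ℂ) * Complex.I) = (x : ℂ) + ((-t : ℝ) : ℂ) * Complex.I := by
    intro t; simp [hρ]; ring
  have hρx : ρ (x : ℂ) = (x : ℂ) := by simp [hρ]; ring
  -- hypotheses of the `y ≥ 0` lemma for `F'` at height `−y`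
  have hmem' : ∀ t ∈ Icc (0:ℝ) (-y), (x : ℂ) + (t : ℂ) * Complex.I ∈ U' := by
    intro t ht
    show ρ ((x : ℂ) + (t : ℂ) * Complex.I) ∈ U
    rw [hρt t]
    exact hmem (-t) ⟨by linarith [ht.2], by linarith [ht.1]⟩
  have hxU : (x : ℂ) ∈ U := by
    have := hmem 0 ⟨hy, le_rfl⟩; simpa using this
  have hdev' : ∀ t ∈ Icc (0:ℝ) (-y), ‖deriv F' ((x : ℂ) + (t : ℂ) * Complex.I) - deriv F' (x : ℂ)‖ ≤ β₁ := by
    intro t ht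
    have hm : ρ ((x : ℂ) + (t : ℂ) * Complex.I) ∈ U := hmem' t ht
    rw [hderiv _ hm, hderiv _ (by rw [hρx]; exact hxU), hρt t, hρx]
    have e : -deriv F ((x : ℂ) + ((-t : ℝ) : ℂ) * Complex.I) - -deriv F (x : ℂ) =
        -(deriv F ((x : ℂ) + ((-t : ℝ) : ℂ) * Complex.I) - deriv F (x : ℂ)) := by abel
    rw [e, norm_neg]
    exact hdev (-t) ⟨by linarith [ht.2], by linarith [ht.1]⟩
  have h := vertical_sub_linear_norm_le hU'o hF'd (by linarith : 0 ≤ -y) hmem' hdev'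
  -- translate back
  have e1 : F' ((x : ℂ) + ((-y : ℝ) : ℂ) * Complex.I) = F ((x : ℂ) + (y : ℂ) * Complex.I) := by
    show F (ρ _) = _; rw [hρt]; simp
  have e2 : F' (x : ℂ) = F (x : ℂ) := by show F (ρ _) = _; rw [hρx]
  have e3 : deriv F' (x : ℂ) = -deriv F (x : ℂ) := by rw [hderiv _ (by rw [hρx]; exact hxU), hρx]
  rw [e1, e2, e3] at h
  have e4 : F ((x : ℂ) + (y : ℂ) * Complex.I) - F (x : ℂ) - (((-y : ℝ) : ℂ) * Complex.I) • -deriv F (x : ℂ) =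
      F ((x : ℂ) + (y : ℂ) * Complex.I) - F (x : ℂ) - ((y : ℂ) * Complex.I) • deriv F (x : ℂ) := by
    rw [smul_neg, Complex.ofReal_neg, neg_mul, neg_smul, neg_neg]
  rw [e4] at h
  rw [abs_of_nonpos hy]
  linarith

/-- **Vertical displacement minus its linear part, any sign.**  `‖F(x+iy) − F(x) − (iy)•F′(x)‖ ≤ β₁·|y|` whenever
`‖F′(x+it) − F′(x)‖ ≤ β₁` for all `t ∈ uIcc 0 y` (and those points lie in the open set `U`). [folklore] -/
theorem vertical_sub_linear_norm_le_abs {U : Set ℂ} (hU : IsOpen U) {F : ℂ → (Fin 3 → ℂ)} (hF : DifferentiableOn ℂ F U)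
    {x y β₁ : ℝ} (hmem : ∀ t ∈ uIcc 0 y, (x : ℂ) + (t : ℂ) * Complex.I ∈ U)
    (hdev : ∀ t ∈ uIcc 0 y, ‖deriv F ((x : ℂ) + (t : ℂ) * Complex.I) - deriv F (x : ℂ)‖ ≤ β₁) :
    ‖F ((x : ℂ) + (y : ℂ) * Complex.I) - F (x : ℂ) - ((y : ℂ) * Complex.I) • deriv F (x : ℂ)‖ ≤ β₁ * |y| := by
  rcases le_total 0 y with hy | hy
  · rw [uIcc_of_le hy] at hmem hdev
    rw [abs_of_nonneg hy]
    exact vertical_sub_linear_norm_le hU hF hy hmem hdev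
  · rw [uIcc_of_ge hy] at hmem hdev
    exact vertical_sub_linear_norm_le_nonpos hU hF hy hmem hdev

end Summit.NavierStokesRegularity.NavierStokesRegularity.Theorems.StadiumVerticalLinearAbs

end
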